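import Summits.ResolutionOfSingularities.ResolutionOfSingularities.Theorems.MarkedTransferCampaignW46MohWindowShadePolyStatement
import Summits.ResolutionOfSingularities.ResolutionOfSingularities.Theorems.MarkedTransferCampaignW46MohWindowSurfaceInstance
import Summits.ResolutionOfSingularities.ResolutionOfSingularities.Theorems.MarkedTransferCampaignW46MohWindowShadeCleaning
import HarnessLib

/-!
# [OURS · L1 W4.6 rung (iii)] NON-VACUITY of the polynomial purely inseparable surface window regime: the purely inseparable surfaces
# `((z^p + x^d + y^d)·𝒪, p)` on `𝔸³_K`, `p < d < 2p`, inhabit `Regime.mohWindowSurfacePoly` (every prime `p`, every field `K`)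

Cell `res-hironaka`, LADDER-RESOLUTION rung L (D-0089), slot W4.6 rung (iii); seat res-L1-s46-pv-6 (gen 4). Host route MarkedTransfer,
`--supports stmt-ResolutionOfSingularities-16155 --as helper`; kind proof (no definition).

WHY. DESIGN POINT (VAC) of `…MohWindowShadePolyStatement.lean`: the sub-regime `Regime.mohWindowSurfacePoly` (o1's
`regimeMohWindowSurfaceInsep` plus a POLYNOMIAL presentation `MohWindowSurfacePolyAt p (germConst A ξ) J_ξ` at every singular point) must be
shown inhabited by a SINGULAR standard state, so that the rung `MohWindowSurfacePolyPermissiblyTerminates` (CLOSED over algebraically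
closed fields in `…MohWindowShadePolyTerminates.lean`) quantifies over something. res-D-pv-029 AS res-L1-s46-pv-13's instance
`…MohWindowSurfaceInstance.lean` (p499871) puts `E_d = ((z^p + x^d + y^d)·𝒪, p)` on `𝔸³_K` in `regimeMohWindowSurfaceInsep` with
`Sing(E_d) = {origin}`; this file adds the polynomial presentation at the origin: regular system `(x/1, y/1, z/1)`, CLEANED polynomial
`F = y₀^d + y₁^d ∈ K[y₀, y₁]` (`p ∤ d`), `ord₀ F = d ∈ (p, 2p)`, `J_0 = ((z/1)^p + F(x/1, y/1))` — the constants do not even enter since the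
coefficients of `F` are `1`.
* `regime_mohWindowSurfacePoly` — `E_d ∈ Regime.mohWindowSurfacePoly` for `p < d < 2p`;
* `exists_singular_state_mohWindowSurfacePoly` — for every prime `p` and field `K` of characteristic `p` the regime contains a STANDARD
  state with NON-EMPTY singular locus (`d = p + 1`).

HONEST FRAMING. Nothing here is a statement of H. Hironaka's manuscript [Hironaka2017] (2017-03-23 — scope only, under adjudication) and
nothing asserts that any statement of it holds. AI-written; AI review is weaker than expert review. No `sorry`; axioms standard.
References: H. Hauser, Bull. AMS 47 (2010) §§F–G (purely inseparable surfaces, cleaning). [Hauser2010] [folklore]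
-/

noncomputable section

set_option linter.dupNamespace false -- mandated namespace of this single-conjunct summit

open CategoryTheory AlgebraicGeometry TopologicalSpace IsLocalRing MvPolynomial

namespace Summit.ResolutionOfSingularities.ResolutionOfSingularities.Theorems

namespace CampaignW46

namespace MohWindowShadePolyWitness

open Literature.AlgebraicGeometry.Resolution Scheme.IdealSheafData
open Literature.AlgebraicGeometry.Resolution.Hauser2010
open Literature.AlgebraicGeometry.Hironaka2017.S02Preliminaries
open Literature.AlgebraicGeometry.Hironaka2017.SpecOrders
open Literature.AlgebraicGeometry.Hironaka2017
open SurfacePlane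

universe u

variable (p : ℕ) [hp : Fact p.Prime] (K : Type u) [Field K] [CharP K p]

/-- The cleaned binomial `y₀^d + y₁^d ∈ K[y₀, y₁]`: coefficients. [folklore] -/
theorem coeff_binom (d : ℕ) (e : Fin 2 →₀ ℕ) :
    coeff e (X 0 ^ d + X 1 ^ d : MvPolynomial (Fin 2) K) =
      (if Finsupp.single 0 d = e then 1 else 0) + (if Finsupp.single 1 d = e then 1 else 0) := by
  rw [coeff_add, coeff_X_pow, coeff_X_pow]

omit hp [CharP K p] in
/-- `ord₀ (y₀^d + y₁^d) = d` (`d ≥ 1`). [cite: Hauser2010, §C (order at a point)] -/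
theorem ordZero_binom {d : ℕ} (hd : d ≠ 0) : ordZero (X 0 ^ d + X 1 ^ d : MvPolynomial (Fin 2) K) = d := by
  classical
  rw [ordZero_eq_nat_iff]
  refine ⟨⟨Finsupp.single 0 d, ?_, by rw [Finsupp.degree_single]⟩, fun e he => ?_⟩
  · rw [coeff_binom, if_pos rfl, if_neg, add_zero]
    · exact one_ne_zero
    · intro h; exact absurd ((Finsupp.single_left_inj hd).mp h) (by decide)
  · rw [coeff_binom, if_neg, if_neg, add_zero]
    · rintro h; rw [← h, Finsupp.degree_single] at he; exact lt_irrefl _ he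
    · rintro h; rw [← h, Finsupp.degree_single] at he; exact lt_irrefl _ he

omit hp [CharP K p] in
/-- `y₀^d + y₁^d` is CLEANED when `p ∤ d`. [cite: Hauser2010, §G (cleaning of p-th power monomials)] -/
theorem deletePthPowers_binom {d : ℕ} (hd : ¬ p ∣ d) :
    deletePthPowers p (X 0 ^ d + X 1 ^ d : MvPolynomial (Fin 2) K) = X 0 ^ d + X 1 ^ d := by
  classical
  refine MohWindowShadeCleaning.deletePthPowers_eq_self_of_forall p fun e he hP => ?_
  rw [MvPolynomial.mem_support_iff, coeff_binom] at he
  rw [isPthPowerExponent_iff] at hP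
  by_cases h0 : Finsupp.single (0 : Fin 2) d = e
  · have := hP 0; rw [← h0, Finsupp.single_eq_same] at this; exact hd this
  · by_cases h1 : Finsupp.single (1 : Fin 2) d = e
    · have := hP 1; rw [← h1, Finsupp.single_eq_same] at this; exact hd this
    · rw [if_neg h0, if_neg h1, add_zero] at he; exact he rfl

/-- **[OURS · W4.6 rung (iii)-NV] `E_d = ((z^p + x^d + y^d)·𝒪, p)` on `𝔸³_K` lies in `Regime.mohWindowSurfacePoly` for `p < d < 2p`.**
NOT a statement of the manuscript. [cite: Hauser2010, §F (setting f = x^p + y^r g)] -/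
theorem regime_mohWindowSurfacePoly {d : ℕ} (hpd : p < d) (hd2 : d < 2 * p) :
    Regime.mohWindowSurfacePoly (p := p) (K := K) (spaceAmbientDatum K p)
      ⟨shf (R3 K) (Ideal.span {X 2 ^ p + X 0 ^ d + X 1 ^ d}), p⟩ := by
  classical
  have hd := not_dvd_of_window p hpd hd2
  refine ⟨regime_mohWindowSurfaceInsep p K hpd hd2, fun ξ hξ => ?_⟩
  have hx : ξ.asIdeal = originIdeal K 3 := (mem_sing_iff p K hpd hd ξ).mp hξ
  refine ⟨isRegularLocalRing_stalk p K ξ, spanFinrank_maximalIdeal_stalk_origin p K hx,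
    algebraMap (R3 K) (St (R3 K) ξ) (X 0), algebraMap (R3 K) (St (R3 K) ξ) (X 1), algebraMap (R3 K) (St (R3 K) ξ) (X 2),
    (maximalIdeal_stalk_origin K hx).symm, X 0 ^ d + X 1 ^ d, deletePthPowers_binom p K hd, ?_, ?_, ?_⟩
  · rw [ordZero_binom K (by omega)]; exact_mod_cast hpd
  · rw [ordZero_binom K (by omega)]; exact_mod_cast hd2
  · show stalkIdeal (shf (R3 K) (Ideal.span {X 2 ^ p + X 0 ^ d + X 1 ^ d})) ξ = _
    rw [stalkIdeal_eq_span, eval₂_add, eval₂_pow, eval₂_pow, eval₂_X, eval₂_X]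
    rfl

/-- **[OURS · W4.6 rung (iii)-NV, headline] for EVERY prime `p` and EVERY field `K` of characteristic `p` the polynomial purely
inseparable surface window regime contains a STANDARD state with NON-EMPTY singular locus** (`((z^p + x^(p+1) + y^(p+1))·𝒪, p)` on
`𝔸³_K`). NOT a statement of the manuscript. [folklore] -/
theorem exists_singular_state_mohWindowSurfacePoly :
    ∃ (A : AmbientDatum p K) (E : IdealExponent A.Z),
      Regime.mohWindowSurfacePoly (p := p) (K := K) A E ∧ E.IsStandard ∧ E.sing.Nonempty := by
  have hp2 : 2 ≤ p := hp.out.two_le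
  exact ⟨spaceAmbientDatum K p, ⟨shf (R3 K) (Ideal.span {X 2 ^ p + X 0 ^ (p + 1) + X 1 ^ (p + 1)}), p⟩,
    regime_mohWindowSurfacePoly p K (Nat.lt_succ_self p) (by omega), isStandard p K (Nat.lt_succ_self p),
    sing_nonempty p K (Nat.lt_succ_self p) (not_dvd_of_window p (Nat.lt_succ_self p) (by omega))⟩

end MohWindowShadePolyWitness

end CampaignW46

end Summit.ResolutionOfSingularities.ResolutionOfSingularities.Theorems

end
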